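import Summits.QuantumFields.BalabanUV.Beta.D1BFx.NeedleProjLetters
import Summits.QuantumFields.BalabanUV.Beta.D1BFx.NeedlePotentialProfile
import Summits.QuantumFields.BalabanUV.Beta.D1BFx.GluonLegProfileD1
import Summits.QuantumFields.BalabanUV.Beta.D1BFx.LatticeHLSDamped
import Summits.QuantumFields.BalabanUV.Beta.D1BFx.LatticeHLSPairing

/-!
# `BalabanUV.Beta.D1BFx.NeedleNdlProjLetters` — road «BF-x» for binder row D1, slot (K), END row `hGrp gN`, «GN-33 ∕ NP» LETTERS (needle side): THE THREE
# NEEDLE-POTENTIAL FACTORS OF THE `ndl ⊗ proj` WORD (`NeedleNdlShape.bubble_ndl_dJetSw`) — the point value `(Ga ∇row_u)(x,α)` (the damped `Φ_u` letter) and the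
# pairings `⟨∇row_u, Ga ∇_col P(·,q)⟩`, `⟨Ga ∇row_u, ∇_row P(p,·)⟩` — EACH KEPT AS `Σ_{s∈B(blk u)} |qJet_u s|·(…)` so that the bond census enters at the (1.22) sum,
# modulo [B5, Prop. 1.2] ∧ [B5, (1.126)–(1.127)] BY NAME (an3-g57 `N36-SPLIT.v1.md` §3′ (2)∕(4) R1⊗R3: «`(Ga∇row)(u′,μ) = −Σ_x ∇Ga(u′;x)·row(x) ≤ Φ_b(u′)` … the
# profile letter is REQUIRED here», «`⟨g′, Ga∇row⟩ ≤ m_{g′}·sup Φ = k n^{λ−7}`»)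

HONEST DEPENDENCY (cell records, verbatim): «continuum YM on T⁴ ⇐ BetaPertH ∧ nine spine estimates (0/9 proved); BetaPertH ⇐ (D1) ∧ (D4) ∧
CAP+tail; G-an2-4 gates asym, D1 and NE2/3/4.»  HONEST FRAMING (cell contract, verbatim): «discharging `BetaPertH` makes Bałaban's UV stability
UNCONDITIONAL — a real constructive-QFT result; it is NOT the continuum limit and NOT the Clay problem.»  THIS MODULE DISCHARGES NOTHING of the
wall: [folklore] lattice bookkeeping BY NAME over leaf-04-g9's (L1)-D1 profile `GluonLegProfileD1.exists_abs_Ga_diff_le_profile` and HLS kit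
(`LatticeHLSDamped.abs_sum_mul_le_of_damped_profiles`, `LatticeHLSProfiles.sum_pow_mul_exp_div_nrm_pow_free_scale_le`, `summable_and_abs_tsum_le_of_abs_sum_le`),
gan24-leaf-05-g41's needle-weighted profiles `NeedlePotentialProfile.abs_ndlRow_le_needle_profile` ∕ `abs_ndlRow_diff_le_needle_profile`, the owner's (kC) letter
`NeedleProjLetters.exists_applyK_colGrad_le` and `ProjectorSupNorm.abs_Pgt_diff_right_le_sup`.  No `def`, no `def … : Prop`, nothing cited, 0 sorry; the printed
statements are HYPOTHESES by name.  Root-level binders hW ∕ hR-sockets ∕ hSX-socket ∕ D1Tel ∕ D1Rep — 0 discharged; (K) NOT closed; NOT D1, NOT `BetaPertH`,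
NOT continuum, NOT Clay.

ABSOLUTE RULE (cell charter, verbatim): «No internally-minted statement may enter as a cited fact. Every hypothesis is either kernel-proved in
this package or a verbatim quotation of a PUBLISHED theorem with page reference. The manuscript(s) under audit are NOT citable for their own
disputed steps — they are the thing under adjudication; programme-internal (2001/route/tribunal) claims are never citable.»

WHY (owner d1-p2-g10 claim table «GN-CELLS» = `GLUON-NEEDLE-ROWS.md` v0.2, cell NP; RULING ρ-g10-7, journal 2026-08-21T11:15Z: «NEEDLE-SIDE LETTERS = YOURS …
the needle mass `q_u := Σ_{s∈B(blk u)} |qJet_u s|` KEPT»; the column-side letters are the owner's `NeedleColumnLetters`).  The `ndl ⊗ proj` word of T₃ is, by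
`NeedleNdlShape.bubble_ndl_dJetSw`, `[⟨∇ρ, Ga c′⟩·(Ga∇C)(b,ν) − (∇ρ Ga)(b,ν)·⟨Ga∇C, r′⟩] − [⟨∇C, Ga c′⟩·(Ga∇ρ)(b,ν) − (∇C Ga)(b,ν)·⟨Ga∇ρ, r′⟩]` (`ρ = row_u`,
`u = b + w` the needle bond, `c′`∕`r′` the projector column∕row gradients at `b + e_ν`).  This file bounds the three factors that contain the needle potential,
never through a sup in `u`: every bound is `Σ_{s∈B(blk u)} |qJet_u s|` times an explicit function of `x − s`, because only the bond marginal
`Σ_u |qJet_u s| ≤ (n−1)·n⁻⁴` (M7) — applied AFTER the `w`-sum — pays the `n³` that a level-uniform sup would lose (an3 §3′ (6)).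

CONTENT (`a > 0`, `n ≥ 1`; `Pt = Site 4 = ℤ⁴`).
* §1 [folklore] `supNorm_le_supNorm_add_unitVec`, `profile_shift_le` (moving the centre of a damped degree-1 profile by a unit vector costs `2e^{ε}`),
  **`applyK_grad_eq`** (summation by parts under `applyK`: `(A ∇f)(x,α) = Σ_b Σ'_y (A x (y−e_b) α b − A x y α b)·f y` for a spread leg and a bounded `f`),
  **`exists_applyK_grad_row_le`** — THE DAMPED `Φ_u` LETTER `|(Ga ∇row_u)(x,α)| ≤ (kΦ∕n²)·Σ_s |qJet_u s|·e^{−(ε₀∕n)‖x−s‖∞}∕nrm(x−s)` (d1 leg profile, degree 3, ⊛ needle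
  profile, degree 2 ↦ degree 1).
* §2 [folklore] **`exists_pairing_grad_row_applyK_colGrad_le`** (`|⟨∇row_u, Ga c′⟩| ≤ (k₅∕n⁴)·Σ_s|qJet_u s|`: damped d1 needle profile × the (kC) sup `kC∕n³`, the damped
  degree-3 sum is `O(n)`), **`exists_pairing_applyK_grad_row_rowGrad_le`** (`|⟨Ga ∇row_u, r′⟩| ≤ (k₆∕n⁴)·Σ_s|qJet_u s|`: `Φ_u` × `|∇_row P| ≤ cPPs∕n⁵`, the damped degree-1
  sum is `O(n³)`).
NOT HERE (honest): the column-side letters (owner, `NeedleColumnLetters` p264178); the cell's (1.22) sum and base average (`NeedleNdlProjRow`).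
Unit `b2b-balaban-beta-d1-formalise-leaf-01` (gen 15), D1 formalisation swarm LEAF PROVER 01 on cross-road kernel duty; `LEAVES-BFx.md` row (N) «GN-33∕NP» letters.
-/

noncomputable section

namespace Summit.QuantumFields.BalabanUV.Beta.D1BFx.NeedleNdlProjLetters

open Finset
open scoped BigOperators
open Literature.MathematicalPhysics.QuantumFieldTheory.Balaban1983to89
open Literature.MathematicalPhysics.QuantumFieldTheory.Balaban1983to89.Beta
open B12Sec2to5 (l1 l1_nonneg)
open B6QGQLower276 (X e blk B mem_B)
open ExpKernelCalculus (Site MKer Decays summable_exp_shift)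
open DyadicShell (Pt)
open Beta.PoissonInterior (nrm nrm_pos one_le_nrm nrm_neg supNorm_le_nrm)
open AffineAveraging (unitVec)
open VectorTailsLoc (fam kfam)
open Summit.QuantumFields.BalabanUV.Beta.TameKernelCalculus (Spr)
open Summit.QuantumFields.BalabanUV.Beta.D1BFx.RProjector (Pgt Pgt_symm deltaPP deltaPP_pos)
open Summit.QuantumFields.BalabanUV.Beta.D1BFx.ProjectorSupNorm (cPPs cPPs_nonneg abs_Pgt_diff_right_le_sup)
open Summit.QuantumFields.BalabanUV.Beta.D1BFx.GluonLeg (Ga Ga_apply Ga_symm)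
open Summit.QuantumFields.BalabanUV.Beta.D1BFx.GluonLegTails (spr_Ga_of_prop12)
open Summit.QuantumFields.BalabanUV.Beta.D1BFx.FrozenLegTails (nOf MOf hn1)
open Summit.QuantumFields.BalabanUV.Beta.D1BFx.GhostStencil (qJet)
open Summit.QuantumFields.BalabanUV.Beta.D1BFx.GluonLegProfileD1 (exists_abs_Ga_diff_le_profile)
open Summit.QuantumFields.BalabanUV.Beta.D1BFx.RankOneBubble (applyK applyKT pairing applyK_apply applyKT_apply pairing_def)
open Summit.QuantumFields.BalabanUV.Beta.D1BFx.RankOneBubbleJets (grad grad_apply colGrad rowGrad)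
open Summit.QuantumFields.BalabanUV.Beta.D1BFx.NeedleProjLetters (unitVec_eq_e')
open Summit.QuantumFields.BalabanUV.Beta.D1BFx.NeedlePotentialLetters (ndlRow ndlRow_def abs_ndlRow_le)
open Summit.QuantumFields.BalabanUV.Beta.D1BFx.NeedlePotentialProfile (abs_ndlRow_le_needle_profile abs_ndlRow_diff_le_needle_profile)
open Summit.QuantumFields.BalabanUV.Beta.D1BFx.RColumnBlockMass (dR cR dR_pos cR_nonneg)
open Summit.QuantumFields.BalabanUV.Beta.D1BFx.RColumnProfile (kV kP)
open Summit.QuantumFields.BalabanUV.Beta.D1BFx.LatticeHLSProfiles (summable_and_abs_tsum_le_of_abs_sum_le)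

variable (a : ℝ) (ha : 0 < a)

/-! ## §1 `(Ga ∇row_u)(x)`: summation by parts against the d1 profile of the leg — the damped `Φ_u` letter, needle weights kept -/

/-- [folklore] `‖v‖∞ ≤ ‖v + e_b‖∞ + 1`. -/
theorem supNorm_le_supNorm_add_unitVec (v : Site 4) (b : Fin 4) :
    (PoissonInterior.supNorm (d := 4) v : ℝ) ≤ PoissonInterior.supNorm (d := 4) (v + unitVec b) + 1 := by
  have h := PoissonInterior.supNorm_sub_le (d := 4) v (-(unitVec b))
  rw [sub_neg_eq_add] at h
  have h1 : PoissonInterior.supNorm (d := 4) (-(unitVec b) : Site 4) = 1 := by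
    rw [PoissonInterior.supNorm_neg, ← LatticeHLSProfiles.supNorm_dyadic]
    exact TwoPowerLegs.supNorm_unitVec b
  rw [h1] at h
  exact_mod_cast h

/-- [folklore] **SHIFTING THE CENTRE OF A DEGREE-ONE DAMPED PROFILE BY A UNIT VECTOR** costs `2·e^{ε}`:
`e^{−ε‖v+e_b‖}∕nrm(v+e_b) ≤ 2·e^{ε}·e^{−ε‖v‖}∕nrm v` (`ε ≥ 0`). -/
theorem profile_shift_le {ε : ℝ} (hε : 0 ≤ ε) (v : Site 4) (b : Fin 4) :
    Real.exp (-ε * PoissonInterior.supNorm (d := 4) (v + unitVec b)) / nrm (v + unitVec b) ^ 1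
      ≤ 2 * Real.exp ε * (Real.exp (-ε * PoissonInterior.supNorm (d := 4) v) / nrm v ^ 1) := by
  have hs := supNorm_le_supNorm_add_unitVec v b
  have hn1 := one_le_nrm (d := 4) (v + unitVec b)
  have hn0 := nrm_pos (d := 4) v
  have h2 := supNorm_le_nrm (d := 4) (v + unitVec b)
  have hnrm : nrm v ≤ 2 * nrm (v + unitVec b) := by
    rw [LatticeHLSRadial.nrm_eq_max v]
    exact max_le (by linarith) (by linarith)
  have hexp : Real.exp (-ε * PoissonInterior.supNorm (d := 4) (v + unitVec b)) ≤ Real.exp ε * Real.exp (-ε * PoissonInterior.supNorm (d := 4) v) := by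
    rw [← Real.exp_add, Real.exp_le_exp]; nlinarith
  rw [pow_one, pow_one, div_le_iff₀ (lt_of_lt_of_le one_pos hn1)]
  calc Real.exp (-ε * PoissonInterior.supNorm (d := 4) (v + unitVec b))
      ≤ Real.exp ε * Real.exp (-ε * PoissonInterior.supNorm (d := 4) v) := hexp
    _ = Real.exp ε * (Real.exp (-ε * PoissonInterior.supNorm (d := 4) v) / nrm v) * nrm v := by field_simp
    _ ≤ Real.exp ε * (Real.exp (-ε * PoissonInterior.supNorm (d := 4) v) / nrm v) * (2 * nrm (v + unitVec b)) :=
        mul_le_mul_of_nonneg_left hnrm (by positivity)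
    _ = 2 * Real.exp ε * (Real.exp (-ε * PoissonInterior.supNorm (d := 4) v) / nrm v) * nrm (v + unitVec b) := by ring

/-- [folklore] **SUMMATION BY PARTS UNDER `applyK`**: for a spread leg `A` and a bounded site function `f`,
`(A ∇f)(x,α) = Σ_b Σ'_y (A x (y−e_b) α b − A x y α b)·f y`. -/
theorem applyK_grad_eq {A : MKer 4 (Fin 4)} (hA : Spr A) {f : Site 4 → ℝ} (hf : ∃ M, ∀ y, |f y| ≤ M) (x : Site 4) (α : Fin 4) :
    applyK A (grad f) x α = ∑ b : Fin 4, ∑' y : Site 4, (A x (y - unitVec b) α b - A x y α b) * f y := by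
  obtain ⟨C, δ, hδ, hAd⟩ := hA
  obtain ⟨M, hM⟩ := hf
  have hC0 : 0 ≤ C := hAd.nonneg α
  have hM0 : 0 ≤ M := (abs_nonneg _).trans (hM x)
  -- summability of the two pieces, for each fibre index
  have hs1 : ∀ b : Fin 4, Summable fun y : Site 4 => A x y α b * f (y + unitVec b) := fun b =>
    Summable.of_norm_bounded (g := fun y => C * Real.exp (-δ * l1 (x - y)) * M) (((summable_exp_shift hδ x).mul_left C).mul_right M)
      fun y => by rw [Real.norm_eq_abs, abs_mul]; exact mul_le_mul (hAd x y α b) (hM _) (abs_nonneg _) (by positivity)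
  have hs2 : ∀ b : Fin 4, Summable fun y : Site 4 => A x y α b * f y := fun b =>
    Summable.of_norm_bounded (g := fun y => C * Real.exp (-δ * l1 (x - y)) * M) (((summable_exp_shift hδ x).mul_left C).mul_right M)
      fun y => by rw [Real.norm_eq_abs, abs_mul]; exact mul_le_mul (hAd x y α b) (hM _) (abs_nonneg _) (by positivity)
  have hs3 : ∀ b : Fin 4, Summable fun y : Site 4 => A x (y - unitVec b) α b * f y := fun b =>
    Summable.of_norm_bounded (g := fun y => C * Real.exp (-δ * l1 (x + unitVec b - y)) * M)
      (((summable_exp_shift hδ (x + unitVec b)).mul_left C).mul_right M)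
      fun y => by
        rw [Real.norm_eq_abs, abs_mul]
        have h1 := hAd x (y - unitVec b) α b
        have e1 : x - (y - unitVec b) = x + unitVec b - y := by abel
        rw [e1] at h1
        exact mul_le_mul h1 (hM _) (abs_nonneg _) (by positivity)
  have hstep : ∀ b : Fin 4, ∑' y : Site 4, A x y α b * (f (y + unitVec b) - f y)
      = ∑' y : Site 4, (A x (y - unitVec b) α b - A x y α b) * f y := by
    intro b
    have e1 : (fun y : Site 4 => A x y α b * (f (y + unitVec b) - f y)) = fun y => A x y α b * f (y + unitVec b) - A x y α b * f y :=
      funext fun y => by ring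
    have e2 : (fun y : Site 4 => (A x (y - unitVec b) α b - A x y α b) * f y) = fun y => A x (y - unitVec b) α b * f y - A x y α b * f y :=
      funext fun y => by ring
    rw [e1, e2, (hs1 b).tsum_sub (hs2 b), (hs3 b).tsum_sub (hs2 b)]
    congr 1
    have h := (Equiv.addRight (unitVec b : Site 4)).tsum_eq (fun t : Site 4 => A x (t - unitVec b) α b * f t)
    simp only [Equiv.coe_addRight, add_sub_cancel_right] at h
    exact h
  rw [applyK_apply]
  have e0 : (fun y : Site 4 => ∑ b : Fin 4, A x y α b * grad f y b) = fun y => ∑ b : Fin 4, A x y α b * (f (y + unitVec b) - f y) := rfl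
  rw [e0, Summable.tsum_finsetSum (fun b _ => ?_)]
  · exact Finset.sum_congr rfl fun b _ => hstep b
  · have e1 : (fun y : Site 4 => A x y α b * (f (y + unitVec b) - f y)) = fun y => A x y α b * f (y + unitVec b) - A x y α b * f y :=
      funext fun y => by ring
    rw [e1]; exact (hs1 b).sub (hs2 b)

/-- [folklore] **THE `Φ_u` LETTER: `|(Ga ∇row_u)(x,α)| ≤ (kΦ∕n²)·Σ_{s∈B(blk u)} |qJet_u s|·e^{−(ε₀∕n)‖x−s‖∞}∕nrm(x−s)`** for every `n ≥ 1`, `κ`, `u`, `x`, `α`, modulo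
[B5, Prop. 1.2] ∧ [B5, (1.126)–(1.127)] BY NAME (an3 §3′ (2)∕(4): «`(Ga∇row)(u′,μ) = −Σ_x ∇Ga(u′;x)·row(x) ≤ Φ_b(u′)` … the profile letter is REQUIRED here»):
summation by parts (`applyK_grad_eq`), the d1 profile `GluonLegProfileD1.exists_abs_Ga_diff_le_profile` (degree 3, damped) against leaf-05's needle-weighted
degree-2 profile `NeedlePotentialProfile.abs_ndlRow_le_needle_profile`, site by needle site through leaf-04-g9's damped HLS `LatticeHLSDamped.abs_sum_mul_le_of_damped_profiles`
(3 + 2 − 4 = 1), the unit shift of the centre by `profile_shift_le`. -/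
theorem exists_applyK_grad_row_le (h12 : B5.Prop12Printed (fam nOf hn1 MOf a ha)) (h126 : B5.Kernel126_127Printed (kfam nOf MOf)) :
    ∃ kΦ ε₀ : ℝ, 0 < ε₀ ∧ 0 ≤ kΦ ∧ ∀ (n : ℕ) [NeZero n] (κ : Fin 4) (u x : Pt) (α : Fin 4),
      |applyK (Ga n a) (grad (ndlRow n a κ u)) x α|
        ≤ kΦ / (n : ℝ) ^ 2 * ∑ s ∈ B (n - 1) (blk (n - 1) u), |qJet n κ u (blk (n - 1) u) s|
            * (Real.exp (-(ε₀ / n) * PoissonInterior.supNorm (d := 4) (x - s)) / nrm (x - s) ^ 1) := by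
  obtain ⟨kG', δ, hδ, hkG', hd1⟩ := exists_abs_Ga_diff_le_profile a ha h12 h126
  have hdR := dR_pos (a := a) ha
  have hkV : 0 ≤ kV a := (RColumnProfile.kV_nonneg_and ha).1
  set ε₀ : ℝ := min δ (dR a / 2) with hε₀
  have hε₀0 : 0 < ε₀ := lt_min hδ (half_pos hdR)
  set cH : ℝ := 4 * 2 ^ (4 + 3) * 9 ^ (4 - 1) with hcH
  refine ⟨4 * (kG' * kV a * cH * (2 * Real.exp ε₀)), ε₀, hε₀0, by positivity, fun n _ κ u x α => ?_⟩
  have hn : (0 : ℝ) < n := by exact_mod_cast Nat.pos_of_ne_zero (NeZero.ne n)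
  have hn1 : (1 : ℝ) ≤ n := by exact_mod_cast NeZero.one_le
  set m : ℕ := n - 1 with hm
  set ε : ℝ := ε₀ / n with hε
  have hε0 : 0 ≤ ε := by positivity
  have hεle : ε ≤ ε₀ := by rw [hε]; exact div_le_self hε₀0.le hn1
  have hεδ : ε ≤ δ / n := div_le_div_of_nonneg_right (min_le_left _ _) hn.le
  have hεR : ε ≤ dR a / 2 / n := div_le_div_of_nonneg_right (min_le_right _ _) hn.le
  have hA : Spr (Ga n a) := spr_Ga_of_prop12 (a := a) (ha := ha) h12 h126 n
  have hbdd : ∃ M, ∀ y, |ndlRow n a κ u y| ≤ M := ⟨((n : ℝ) ^ 4)⁻¹ * (cR a * 1), fun y => (abs_ndlRow_le n κ u ha y).trans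
    (mul_le_mul_of_nonneg_left (mul_le_mul_of_nonneg_left (by
      rw [Real.exp_le_one_iff]; have : 0 ≤ dR a * dist (blk m y) (blk m u) := by positivity
      linarith) (cR_nonneg ha)) (by positivity))⟩
  rw [applyK_grad_eq hA hbdd x α]
  -- the needle-weighted target profile at centre `x`
  set W : Pt → ℝ := fun s => |qJet n κ u (blk m u) s| with hW
  set prof : Pt → ℝ := fun s => Real.exp (-ε * PoissonInterior.supNorm (d := 4) (x - s)) / nrm (x - s) ^ 1 with hprof
  -- one fibre index `b`: the series is dominated on every finite set
  have hfib : ∀ b : Fin 4, ∀ S : Finset Pt, ∑ y ∈ S, |(Ga n a x (y - unitVec b) α b - Ga n a x y α b) * ndlRow n a κ u y|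
      ≤ kG' * kV a * cH * (2 * Real.exp ε₀) / (n : ℝ) ^ 2 * ∑ s ∈ B m (blk m u), W s * prof s := by
    intro b S
    -- the kernel factor: damped degree-3 profile centred at `x + e_b`
    have hK : ∀ y ∈ S, |Ga n a x (y - unitVec b) α b - Ga n a x y α b|
        ≤ kG' * Real.exp (-ε * PoissonInterior.supNorm (d := 4) (y - (x + unitVec b))) / nrm (y - (x + unitVec b)) ^ 3 := by
      intro y _
      have h := hd1 n x (y - unitVec b) α b b
      rw [show BubbleTransfer.unitVec b = unitVec b from rfl, sub_add_cancel] at h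
      rw [abs_sub_comm]
      have e1 : y - unitVec b - x = y - (x + unitVec b) := by abel
      rw [e1] at h
      refine h.trans (div_le_div_of_nonneg_right (mul_le_mul_of_nonneg_left (Real.exp_le_exp.2 ?_) hkG') (pow_nonneg (nrm_pos _).le 3))
      have : (0 : ℝ) ≤ PoissonInterior.supNorm (d := 4) (y - (x + unitVec b)) := by positivity
      nlinarith
    -- the needle potential: needle-weighted damped degree-2 profiles
    have hrow : ∀ y, |ndlRow n a κ u y| ≤ ∑ s ∈ B m (blk m u), W s *
        (kV a / (n : ℝ) ^ 2 * Real.exp (-ε * PoissonInterior.supNorm (d := 4) (y - s)) / nrm (y - s) ^ 2) := by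
      intro y
      refine (abs_ndlRow_le_needle_profile n κ u ha y).trans (Finset.sum_le_sum fun s _ => ?_)
      refine mul_le_mul_of_nonneg_left (div_le_div_of_nonneg_right (mul_le_mul_of_nonneg_left (Real.exp_le_exp.2 ?_) (by positivity))
        (by positivity)) (abs_nonneg _)
      have : (0 : ℝ) ≤ PoissonInterior.supNorm (d := 4) (y - s) := by positivity
      nlinarith
    calc ∑ y ∈ S, |(Ga n a x (y - unitVec b) α b - Ga n a x y α b) * ndlRow n a κ u y|
        ≤ ∑ y ∈ S, |Ga n a x (y - unitVec b) α b - Ga n a x y α b| * ∑ s ∈ B m (blk m u), W s *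
            (kV a / (n : ℝ) ^ 2 * Real.exp (-ε * PoissonInterior.supNorm (d := 4) (y - s)) / nrm (y - s) ^ 2) :=
          Finset.sum_le_sum fun y _ => by rw [abs_mul]; exact mul_le_mul_of_nonneg_left (hrow y) (abs_nonneg _)
      _ = ∑ s ∈ B m (blk m u), W s * ∑ y ∈ S, |Ga n a x (y - unitVec b) α b - Ga n a x y α b| *
            (kV a / (n : ℝ) ^ 2 * Real.exp (-ε * PoissonInterior.supNorm (d := 4) (y - s)) / nrm (y - s) ^ 2) := by
          simp only [Finset.mul_sum]
          rw [Finset.sum_comm]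
          exact Finset.sum_congr rfl fun s _ => Finset.sum_congr rfl fun y _ => by ring
      _ ≤ ∑ s ∈ B m (blk m u), W s * (kG' * (kV a / (n : ℝ) ^ 2) * cH *
            Real.exp (-ε * PoissonInterior.supNorm (d := 4) (x + unitVec b - s)) / nrm (x + unitVec b - s) ^ (3 + 2 - 4)) := by
          refine Finset.sum_le_sum fun s _ => mul_le_mul_of_nonneg_left ?_ (abs_nonneg _)
          have hf0 : ∀ y : Pt, 0 ≤ kV a / (n : ℝ) ^ 2 * Real.exp (-ε * PoissonInterior.supNorm (d := 4) (y - s)) / nrm (y - s) ^ 2 := fun y =>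
            div_nonneg (mul_nonneg (div_nonneg hkV (pow_nonneg hn.le 2)) (Real.exp_pos _).le) (pow_nonneg (nrm_pos _).le 2)
          have h := LatticeHLSDamped.abs_sum_mul_le_of_damped_profiles (d := 4) (by norm_num) (a := 3) (b := 2) (by norm_num) (by norm_num)
            (by norm_num) (K := fun y => Ga n a x (y - unitVec b) α b - Ga n a x y α b)
            (f := fun y => kV a / (n : ℝ) ^ 2 * Real.exp (-ε * PoissonInterior.supNorm (d := 4) (y - s)) / nrm (y - s) ^ 2)
            (κ := kG') (A := kV a / (n : ℝ) ^ 2) (ε := ε) hkG' (div_nonneg hkV (pow_nonneg hn.le 2)) hε0 S (x + unitVec b) s hK (fun y _ => by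
              rw [abs_of_nonneg (hf0 y), mul_div_assoc])
          refine le_trans (le_of_eq (Finset.sum_congr rfl fun y _ => ?_)) (h.trans (le_of_eq (by rw [hcH]; norm_num)))
          rw [abs_mul, abs_of_nonneg (hf0 y)]
      _ ≤ ∑ s ∈ B m (blk m u), W s * (kG' * (kV a / (n : ℝ) ^ 2) * cH * (2 * Real.exp ε₀ * prof s)) := by
          refine Finset.sum_le_sum fun s _ => mul_le_mul_of_nonneg_left ?_ (abs_nonneg _)
          have e1 : x + unitVec b - s = x - s + unitVec b := by abel
          rw [show (3 + 2 - 4 : ℕ) = 1 by norm_num, e1, mul_div_assoc]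
          refine mul_le_mul_of_nonneg_left ((profile_shift_le hε0 (x - s) b).trans ?_) (by positivity)
          exact mul_le_mul_of_nonneg_right (mul_le_mul_of_nonneg_left (Real.exp_le_exp.2 hεle) (by norm_num))
            (div_nonneg (Real.exp_pos _).le (pow_nonneg (nrm_pos _).le 1))
      _ = kG' * kV a * cH * (2 * Real.exp ε₀) / (n : ℝ) ^ 2 * ∑ s ∈ B m (blk m u), W s * prof s := by
          rw [Finset.mul_sum]; exact Finset.sum_congr rfl fun s _ => by field_simp
  -- assemble the four fibre indices
  have hb : ∀ b : Fin 4, |∑' y : Site 4, (Ga n a x (y - unitVec b) α b - Ga n a x y α b) * ndlRow n a κ u y|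
      ≤ kG' * kV a * cH * (2 * Real.exp ε₀) / (n : ℝ) ^ 2 * ∑ s ∈ B m (blk m u), W s * prof s := fun b =>
    (summable_and_abs_tsum_le_of_abs_sum_le (hfib b)).2
  calc |∑ b : Fin 4, ∑' y : Site 4, (Ga n a x (y - unitVec b) α b - Ga n a x y α b) * ndlRow n a κ u y|
      ≤ ∑ b : Fin 4, |∑' y : Site 4, (Ga n a x (y - unitVec b) α b - Ga n a x y α b) * ndlRow n a κ u y| := Finset.abs_sum_le_sum_abs _ _
    _ ≤ ∑ _b : Fin 4, kG' * kV a * cH * (2 * Real.exp ε₀) / (n : ℝ) ^ 2 * ∑ s ∈ B m (blk m u), W s * prof s := Finset.sum_le_sum fun b _ => hb b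
    _ = 4 * (kG' * kV a * cH * (2 * Real.exp ε₀)) / (n : ℝ) ^ 2 * ∑ s ∈ B m (blk m u), W s * prof s := by
        rw [Finset.sum_const, Finset.card_univ, Fintype.card_fin, nsmul_eq_mul]; push_cast; ring
    _ = _ := by rw [hW, hprof, hε]

/-! ## §2 The two needle-side pairings of the `ndl ⊗ proj` word -/

/-- [folklore] **`|⟨∇row_u, Ga c′⟩| ≤ (k₅∕n⁴)·Σ_{s∈B(blk u)} |qJet_u s|`** (`c′ = ∇_col P(·,q)`, any `q`), modulo [B5, Prop. 1.2] ∧ [B5, (1.126)–(1.127)] BY NAME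
(an3 §3′ (4): «`⟨g′, Ga∇row⟩ ≤ m_{g′}·sup Φ = k n^{λ−7}`» — the needle weight `Σ_s|qJet_s| = n^{λ−3}` kept): leaf-05's damped d1 needle profile
`abs_ndlRow_diff_le_needle_profile` (`kP∕n²·e^{−(dR∕2n)‖x−s‖}∕nrm(x−s)³`) against the sup of the (kC) letter (`kC∕n³`), the damped degree-3 sum being `O(n)`
(`LatticeHLSProfiles.sum_pow_mul_exp_div_nrm_pow_free_scale_le`, `p = 3`, `q = 0`). -/
theorem exists_pairing_grad_row_applyK_colGrad_le (h12 : B5.Prop12Printed (fam nOf hn1 MOf a ha)) (h126 : B5.Kernel126_127Printed (kfam nOf MOf)) :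
    ∃ k₅ : ℝ, 0 ≤ k₅ ∧ ∀ (n : ℕ) [NeZero n] (κ : Fin 4) (u q : Pt),
      |pairing (grad (ndlRow n a κ u)) (applyK (Ga n a) (colGrad (Pgt n a) q))|
        ≤ k₅ / (n : ℝ) ^ 4 * ∑ s ∈ B (n - 1) (blk (n - 1) u), |qJet n κ u (blk (n - 1) u) s| := by
  obtain ⟨kC, δ₁, hδ₁, hkC, hKC⟩ := NeedleProjLetters.exists_applyK_colGrad_le a ha h12 h126
  have hdR := dR_pos (a := a) ha
  have hkP : 0 ≤ kP a := (RColumnProfile.kV_nonneg_and ha).2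
  set cR₃ : ℝ := 2 * (Nat.factorial 0) * (2 / (dR a / 2)) ^ 0 *
    (1 + 2 * (4 : ℕ) * 3 ^ (4 - 1) * ((Nat.factorial (4 - 1 - 3)) * (4 / (dR a / 2)) ^ (4 - 1 - 3) * (1 + 4 / (dR a / 2)))) with hcR₃
  have hcR₃0 : 0 ≤ cR₃ := by positivity
  refine ⟨4 * kC * kP a * cR₃, by positivity, fun n _ κ u q => ?_⟩
  have hn : (0 : ℝ) < n := by exact_mod_cast Nat.pos_of_ne_zero (NeZero.ne n)
  have hn1 : 1 ≤ n := NeZero.one_le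
  set m : ℕ := n - 1 with hm
  set W : Pt → ℝ := fun s => |qJet n κ u (blk m u) s| with hW
  set h : Pt → ℝ := fun x => ∑ α : Fin 4, grad (ndlRow n a κ u) x α * applyK (Ga n a) (colGrad (Pgt n a) q) x α with hh
  have hpair : pairing (grad (ndlRow n a κ u)) (applyK (Ga n a) (colGrad (Pgt n a) q)) = ∑' x, h x := rfl
  have hKC' : ∀ (x : Pt) (α : Fin 4), |applyK (Ga n a) (colGrad (Pgt n a) q) x α| ≤ kC / (n : ℝ) ^ 3 := fun x α =>
    (hKC n q x α).trans (mul_le_of_le_one_right (by positivity) (by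
      rw [Real.exp_le_one_iff]; have : 0 ≤ δ₁ * dist (blk m x) (blk m q) := by positivity
      linarith))
  -- the damped degree-3 sum at scale n is `O(n)`
  have hR₃ : ∀ (S : Finset Pt) (s : Pt), ∑ x ∈ S, Real.exp (-(dR a / 2 / n) * PoissonInterior.supNorm (d := 4) (x - s)) / nrm (x - s) ^ 3
      ≤ cR₃ * (n : ℝ) := by
    intro S s
    have h := LatticeHLSProfiles.sum_pow_mul_exp_div_nrm_pow_free_scale_le (d := 4) (by norm_num) (half_pos hdR) hn1 (p := 3) (by norm_num) 0 S s s
    simp only [pow_zero, one_mul] at h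
    refine h.trans (le_of_eq ?_)
    rw [hcR₃, show (4 - 3 + 0 : ℕ) = 1 by norm_num, pow_one]
    simp only [pow_zero, Nat.factorial]
  have hfin : ∀ S : Finset Pt, ∑ x ∈ S, |h x| ≤ 4 * kC * kP a * cR₃ / (n : ℝ) ^ 4 * ∑ s ∈ B m (blk m u), W s := by
    intro S
    have hterm : ∀ (x : Pt) (α : Fin 4), |grad (ndlRow n a κ u) x α * applyK (Ga n a) (colGrad (Pgt n a) q) x α|
        ≤ (∑ s ∈ B m (blk m u), W s * (kP a / (n : ℝ) ^ 2 * Real.exp (-(dR a / 2 / n) * PoissonInterior.supNorm (d := 4) (x - s)) / nrm (x - s) ^ 3))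
          * (kC / (n : ℝ) ^ 3) := by
      intro x α
      rw [abs_mul, grad_apply]
      exact mul_le_mul (abs_ndlRow_diff_le_needle_profile n κ u ha x α) (hKC' x α) (abs_nonneg _)
        (Finset.sum_nonneg fun s _ => mul_nonneg (abs_nonneg _)
          (div_nonneg (mul_nonneg (div_nonneg hkP (pow_nonneg hn.le 2)) (Real.exp_pos _).le) (pow_nonneg (nrm_pos _).le 3)))
    calc ∑ x ∈ S, |h x| ≤ ∑ x ∈ S, ∑ α : Fin 4, |grad (ndlRow n a κ u) x α * applyK (Ga n a) (colGrad (Pgt n a) q) x α| :=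
          Finset.sum_le_sum fun x _ => Finset.abs_sum_le_sum_abs _ _
      _ ≤ ∑ x ∈ S, ∑ _α : Fin 4, (∑ s ∈ B m (blk m u), W s *
            (kP a / (n : ℝ) ^ 2 * Real.exp (-(dR a / 2 / n) * PoissonInterior.supNorm (d := 4) (x - s)) / nrm (x - s) ^ 3)) * (kC / (n : ℝ) ^ 3) :=
          Finset.sum_le_sum fun x _ => Finset.sum_le_sum fun α _ => hterm x α
      _ = 4 * kC * kP a / (n : ℝ) ^ 5 * ∑ s ∈ B m (blk m u), W s *
            ∑ x ∈ S, Real.exp (-(dR a / 2 / n) * PoissonInterior.supNorm (d := 4) (x - s)) / nrm (x - s) ^ 3 := by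
          simp only [Finset.sum_const, Finset.card_univ, Fintype.card_fin, nsmul_eq_mul, Finset.mul_sum, Finset.sum_mul]
          rw [Finset.sum_comm]
          refine Finset.sum_congr rfl fun s _ => Finset.sum_congr rfl fun x _ => ?_
          push_cast; field_simp
      _ ≤ 4 * kC * kP a / (n : ℝ) ^ 5 * ∑ s ∈ B m (blk m u), W s * (cR₃ * (n : ℝ)) := by
          refine mul_le_mul_of_nonneg_left (Finset.sum_le_sum fun s _ => mul_le_mul_of_nonneg_left (hR₃ S s) (abs_nonneg _)) (by positivity)
      _ = 4 * kC * kP a * cR₃ / (n : ℝ) ^ 4 * ∑ s ∈ B m (blk m u), W s := by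
          rw [← Finset.sum_mul]; field_simp
  rw [hpair]
  exact (summable_and_abs_tsum_le_of_abs_sum_le hfin).2

/-- [folklore] **`|⟨Ga ∇row_u, r′⟩| ≤ (k₆∕n⁴)·Σ_{s∈B(blk u)} |qJet_u s|`** (`r′ = ∇_row P(p,·)`, any `p`), modulo [B5, Prop. 1.2] ∧ [B5, (1.126)–(1.127)] BY NAME
(an3 §3′ (4): «`⟨g′, Ga∇row⟩ ≤ m_{g′}·sup Φ = k n^{λ−7}`»): §2's damped `Φ_u` letter (`kΦ∕n²·e^{−(ε₀∕n)‖z−s‖}∕nrm(z−s)`) against the projector row-difference sup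
`cPPs∕n⁵`, the damped degree-1 sum being `O(n³)` (`sum_pow_mul_exp_div_nrm_pow_free_scale_le`, `p = 1`, `q = 0`). -/
theorem exists_pairing_applyK_grad_row_rowGrad_le (h12 : B5.Prop12Printed (fam nOf hn1 MOf a ha)) (h126 : B5.Kernel126_127Printed (kfam nOf MOf)) :
    ∃ k₆ : ℝ, 0 ≤ k₆ ∧ ∀ (n : ℕ) [NeZero n] (κ : Fin 4) (u p : Pt),
      |pairing (applyK (Ga n a) (grad (ndlRow n a κ u))) (rowGrad (Pgt n a) p)|
        ≤ k₆ / (n : ℝ) ^ 4 * ∑ s ∈ B (n - 1) (blk (n - 1) u), |qJet n κ u (blk (n - 1) u) s| := by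
  obtain ⟨kΦ, ε₀, hε₀, hkΦ, hΦ⟩ := exists_applyK_grad_row_le a ha h12 h126
  have hPP := deltaPP_pos 4 ha
  have hcP := cPPs_nonneg 4 ha
  set cR₁ : ℝ := 2 * (Nat.factorial 0) * (2 / ε₀) ^ 0 *
    (1 + 2 * (4 : ℕ) * 3 ^ (4 - 1) * ((Nat.factorial (4 - 1 - 1)) * (4 / ε₀) ^ (4 - 1 - 1) * (1 + 4 / ε₀))) with hcR₁
  have hcR₁0 : 0 ≤ cR₁ := by positivity
  refine ⟨4 * kΦ * cPPs 4 a * cR₁, by positivity, fun n _ κ u p => ?_⟩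
  have hn : (0 : ℝ) < n := by exact_mod_cast Nat.pos_of_ne_zero (NeZero.ne n)
  have hn1 : 1 ≤ n := NeZero.one_le
  set m : ℕ := n - 1 with hm
  set W : Pt → ℝ := fun s => |qJet n κ u (blk m u) s| with hW
  set h : Pt → ℝ := fun z => ∑ β : Fin 4, applyK (Ga n a) (grad (ndlRow n a κ u)) z β * rowGrad (Pgt n a) p z β with hh
  have hpair : pairing (applyK (Ga n a) (grad (ndlRow n a κ u))) (rowGrad (Pgt n a) p) = ∑' z, h z := rfl
  have hr' : ∀ (z : Pt) (β : Fin 4), |rowGrad (Pgt n a) p z β| ≤ cPPs 4 a / (n : ℝ) ^ 5 := fun z β => by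
    simp only [rowGrad]; rw [unitVec_eq_e']
    refine (abs_Pgt_diff_right_le_sup n ha p z β () ()).trans (mul_le_of_le_one_right (by positivity) ?_)
    rw [Real.exp_le_one_iff]; have : 0 ≤ deltaPP 4 a * dist (blk m p) (blk m z) := by positivity
    linarith
  have hR₁ : ∀ (S : Finset Pt) (s : Pt), ∑ z ∈ S, Real.exp (-(ε₀ / n) * PoissonInterior.supNorm (d := 4) (z - s)) / nrm (z - s) ^ 1
      ≤ cR₁ * (n : ℝ) ^ 3 := by
    intro S s
    have h := LatticeHLSProfiles.sum_pow_mul_exp_div_nrm_pow_free_scale_le (d := 4) (by norm_num) hε₀ hn1 (p := 1) (by norm_num) 0 S s s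
    simp only [pow_zero, one_mul] at h
    refine h.trans (le_of_eq ?_)
    rw [hcR₁, show (4 - 1 + 0 : ℕ) = 3 by norm_num]
    simp only [pow_zero, Nat.factorial]
  have hfin : ∀ S : Finset Pt, ∑ z ∈ S, |h z| ≤ 4 * kΦ * cPPs 4 a * cR₁ / (n : ℝ) ^ 4 * ∑ s ∈ B m (blk m u), W s := by
    intro S
    have hterm : ∀ (z : Pt) (β : Fin 4), |applyK (Ga n a) (grad (ndlRow n a κ u)) z β * rowGrad (Pgt n a) p z β|
        ≤ (kΦ / (n : ℝ) ^ 2 * ∑ s ∈ B m (blk m u), W s * (Real.exp (-(ε₀ / n) * PoissonInterior.supNorm (d := 4) (z - s)) / nrm (z - s) ^ 1))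
          * (cPPs 4 a / (n : ℝ) ^ 5) := by
      intro z β
      rw [abs_mul]
      exact mul_le_mul (hΦ n κ u z β) (hr' z β) (abs_nonneg _) (mul_nonneg (by positivity)
        (Finset.sum_nonneg fun s _ => mul_nonneg (abs_nonneg _) (div_nonneg (Real.exp_pos _).le (pow_nonneg (nrm_pos _).le 1))))
    calc ∑ z ∈ S, |h z| ≤ ∑ z ∈ S, ∑ β : Fin 4, |applyK (Ga n a) (grad (ndlRow n a κ u)) z β * rowGrad (Pgt n a) p z β| :=
          Finset.sum_le_sum fun z _ => Finset.abs_sum_le_sum_abs _ _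
      _ ≤ ∑ z ∈ S, ∑ _β : Fin 4, (kΦ / (n : ℝ) ^ 2 * ∑ s ∈ B m (blk m u), W s *
            (Real.exp (-(ε₀ / n) * PoissonInterior.supNorm (d := 4) (z - s)) / nrm (z - s) ^ 1)) * (cPPs 4 a / (n : ℝ) ^ 5) :=
          Finset.sum_le_sum fun z _ => Finset.sum_le_sum fun β _ => hterm z β
      _ = 4 * kΦ * cPPs 4 a / (n : ℝ) ^ 7 * ∑ s ∈ B m (blk m u), W s *
            ∑ z ∈ S, Real.exp (-(ε₀ / n) * PoissonInterior.supNorm (d := 4) (z - s)) / nrm (z - s) ^ 1 := by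
          simp only [Finset.sum_const, Finset.card_univ, Fintype.card_fin, nsmul_eq_mul, Finset.mul_sum, Finset.sum_mul]
          rw [Finset.sum_comm]
          refine Finset.sum_congr rfl fun s _ => Finset.sum_congr rfl fun z _ => ?_
          push_cast; field_simp
      _ ≤ 4 * kΦ * cPPs 4 a / (n : ℝ) ^ 7 * ∑ s ∈ B m (blk m u), W s * (cR₁ * (n : ℝ) ^ 3) := by
          refine mul_le_mul_of_nonneg_left (Finset.sum_le_sum fun s _ => mul_le_mul_of_nonneg_left (hR₁ S s) (abs_nonneg _)) (by positivity)
      _ = 4 * kΦ * cPPs 4 a * cR₁ / (n : ℝ) ^ 4 * ∑ s ∈ B m (blk m u), W s := by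
          rw [← Finset.sum_mul]; field_simp
  rw [hpair]
  exact (summable_and_abs_tsum_le_of_abs_sum_le hfin).2

end Summit.QuantumFields.BalabanUV.Beta.D1BFx.NeedleNdlProjLetters

end
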